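import Summits.ValiantsHypothesis.ValiantsHypothesis.Theorems.LacunarySymmetroidMatrixDescartesDoorA26WallBubblingOrderThreeNoBalanceSix

/-!
# `DoorA26` / line `wall_bubbling` — NO BALANCE AT ORDER 3 WITH PARALLEL TOUCHES (g19's Case A): at most six touches, any mix ⇒ LIFT

HONEST FRAMING.  Object-search cell `pub-symmetroid`, crux `Theses.LacunarySymmetroid.DoorA26` (stmt-ValiantsHypothesis-19979; OPEN, typed,
never asserted).  W2 seat val-sym-door-p1 g20, file #92; def-free helper for obligation (R) of `Cruxes/DoorA26/Lines/wall_bubbling.lean`.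
Imports #91 `…OrderThreeNoBalanceSix` (rulings, pencil calculus, the non-parallel case).

THE THEOREM (`mem_twentyLocus_of_orderThree_sixTouches`).  As #91 (one rank-one triple zero `t⋆`, at most six rank-one touches among six distinct
abscissae), but the touches may now be PARALLEL to `p⋆` (`P(z_j) = c_j·p⋆`) or not (`pol(P(z_j), p⋆) ≠ 0`), provided (i) the parallel touches together
with `t⋆` sit among six distinct abscissae (at most five parallel touches — six are impossible anyway, #53 `false_of_parallel_touches`), and (ii) the
non-degeneracy `P′(t⋆) ∦ p⋆`, witnessed by a matrix `β` with `pol(p⋆, β) = 0 ≠ pol(P′(t⋆), β)`.  Then `δ ∈ TwentyLocus`.  Proof: #91's two rulings kill the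
non-parallel touch multipliers; the ruling `Q = e^{δ₀t}·β` is admissible and its only non-zero row is the slope row at `t⋆`
(`e^{δ₀t⋆}·pol(P′(t⋆), β)`: parallel touch rows are `c_j·pol(p⋆,β) = 0`) — it kills `λ⋆`; finally the scalar ruling `Q = φ·1` with `φ(t⋆) = 0`,
`φ(z_j) = [j = j₀]` on the parallel touches kills each parallel multiplier (rows `φ(z_j)·tr P(z_j)`).  This is g19 memo §7c Case A (main branch
`p⋆′ ∦ p⋆`) in the kernel; with #91 every order-3 profile with at most SIX touches and a non-degenerate rank-one triple zero lifts.  Left at order 3: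
`|J| = 7` (the core, memo g20 §3), `|J| = 8` (g19: no balance by counting, paper), the degenerate slope `P′(t⋆) ∥ p⋆`.

WHAT IS HERE.  ★★★ `mem_twentyLocus_of_orderThree_sixTouches`.  Nothing here bears on `DoorA26`, `DoorA34`, (W)/(M)/(R), `MatrixDescartes` (18050)
or `VP ≠ VNP`; registers unchanged.

[this work] the theorem (g19's Case A, typed against #81).
-/

set_option linter.dupNamespace false

namespace Summit.ValiantsHypothesis.ValiantsHypothesis.Theorems.LacunarySymmetroidMatrixDescartes.WallBubbling

open Finset Filter Topology
open Bubbling (TwentyLocus expSum)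

/-- ★★★ **NO BALANCE AT ORDER 3, up to six touches, parallel or not ⇒ LIFT** (see the module docstring). [this work] -/
theorem mem_twentyLocus_of_orderThree_sixTouches (δ : Fin 6 → ℝ) (hδ : Function.Injective δ) (S : Fin 6 → Matrix (Fin 2) (Fin 2) ℝ)
    (hS : ∀ l, (S l).IsSymm)
    {r : ℕ} (z : Fin r → ℝ) {ρ : ℝ} (hρ : 0 < ρ) (hsep : ∀ i j : Fin r, i < j → z i + ρ ≤ z j - ρ)
    (m : Fin r → ℕ) (hm1 : ∀ j, 1 ≤ m j) (hm3 : ∀ j, m j ≤ 3) (hm : 20 ≤ ∑ j, m j)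
    (hvan : ∀ j, ∀ i < m j, iteratedDeriv i (fun t => (∑ l, Real.exp (δ l * t) • S l).det) (z j) = 0)
    (htop : ∀ j, iteratedDeriv (m j) (fun t => (∑ l, Real.exp (δ l * t) • S l).det) (z j) ≠ 0)
    (jstar : Fin r) (hjstar : m jstar = 3) (huniq : ∀ j, m j = 3 → j = jstar)
    (u : Fin 6 → ℝ) (hu : Function.Injective u) (slot : Fin r → Fin 6) (hslot : ∀ j, m j = 2 → u (slot j) = z j)
    (hslot_inj : ∀ j j', m j = 2 → m j' = 2 → slot j = slot j' → j = j')
    (hclass : ∀ j, m j = 2 →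
      (((∑ l, Real.exp (δ l * z j) • S l) + (∑ l, Real.exp (δ l * z jstar) • S l)).det
        - (∑ l, Real.exp (δ l * z j) • S l).det - (∑ l, Real.exp (δ l * z jstar) • S l).det ≠ 0) ∨
      (∃ c : ℝ, (∑ l, Real.exp (δ l * z j) • S l) = c • (∑ l, Real.exp (δ l * z jstar) • S l)))
    (htrj : ∀ j, m j = 2 → (∑ l, Real.exp (δ l * z j) • S l).trace ≠ 0)
    (u' : Fin 6 → ℝ) (hu' : Function.Injective u') (slot' : Fin r → Fin 6)
    (hslot' : ∀ j, (m j = 2 ∨ m j = 3) → u' (slot' j) = z j)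
    (hslot'_inj : ∀ j j', (m j = 2 ∨ m j = 3) → (m j' = 2 ∨ m j' = 3) → slot' j = slot' j' → j = j')
    (β : Matrix (Fin 2) (Fin 2) ℝ) (hβs : β.IsSymm)
    (hβ0 : ((∑ l, Real.exp (δ l * z jstar) • S l) + β).det - (∑ l, Real.exp (δ l * z jstar) • S l).det - β.det = 0)
    (hβ1 : (∑ l, δ l * Real.exp (δ l * z jstar) * S l 0 0) * β 1 1 + (∑ l, δ l * Real.exp (δ l * z jstar) * S l 1 1) * β 0 0
        - (∑ l, δ l * Real.exp (δ l * z jstar) * S l 0 1) * β 1 0 - (∑ l, δ l * Real.exp (δ l * z jstar) * S l 1 0) * β 0 1 ≠ 0) :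
    δ ∈ TwentyLocus := by
  classical
  rcases mem_twentyLocus_or_generalizedBalance_orderThree δ S hS z hρ hsep m hm1 hm3 hm hvan htop with h | ⟨lam, hl0, hlne, hsimple, hbal⟩
  · exact h
  exfalso
  -- notation
  set P : ℝ → Matrix (Fin 2) (Fin 2) ℝ := fun t => ∑ l, Real.exp (δ l * t) • S l with hP
  set F : ℝ → ℝ := fun t => (P t).det with hF
  set tstar := z jstar with htstar
  set pstar : Matrix (Fin 2) (Fin 2) ℝ := P tstar with hpstar
  have hpsymm : pstar.IsSymm := isSymm_expPencil δ S hS tstar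
  have hdet0 : pstar.det = 0 := by
    have := hvan jstar 0 (by omega); rw [iteratedDeriv_zero] at this; exact this
  have hF1 : deriv F tstar = 0 := by
    have := hvan jstar 1 (by omega); rw [iteratedDeriv_one] at this; exact this
  -- the shift `φ·Y` in coordinates and its first variation
  have hshift : ∀ (c : Fin 6 → ℝ) (Y : Matrix (Fin 2) (Fin 2) ℝ), Y.IsSymm → ∀ t,
      (∑ l, Real.exp (δ l * t) • (!![(fun l => c l * Y 0 0) l, (fun l => c l * Y 0 1) l; (fun l => c l * Y 0 1) l, (fun l => c l * Y 1 1) l] :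
        Matrix (Fin 2) (Fin 2) ℝ)) = (∑ l, c l * Real.exp (δ l * t)) • Y := by
    intro c Y hY t
    rw [← expPencil_smul_const]
    exact Finset.sum_congr rfl fun l _ => by rw [coordLetter_smul_symm Y hY (c l)]
  -- STEP 1: every NON-PARALLEL touch multiplier vanishes (ruling `Q = φ·p⋆`, `φ(z_j) = [j = j₀]`)
  have htouch : ∀ j₀, m j₀ = 2 → ((P (z j₀) + pstar).det - (P (z j₀)).det - pstar.det ≠ 0) → lam j₀ = 0 := by
    intro j₀ hj₀ hp
    obtain ⟨c, hc⟩ := exists_expSum_interpolate δ hδ u hu (fun a => if a = slot j₀ then 1 else 0)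
    -- the coordinate shift of `φ·p⋆`
    let w : Fin 6 → Fin 3 → ℝ := fun l => ![c l * pstar 0 0, c l * pstar 0 1, c l * pstar 1 1]
    have hQ : ∀ t, (∑ l, Real.exp (δ l * t) • (!![w l 0, w l 1; w l 1, w l 2] : Matrix (Fin 2) (Fin 2) ℝ))
        = (∑ l, c l * Real.exp (δ l * t)) • pstar := by
      intro t
      have := hshift c pstar hpsymm t
      simpa only [w, Matrix.cons_val_zero, Matrix.cons_val_one, Matrix.head_cons, Matrix.cons_val_two, Matrix.tail_cons] using this
    have hc1 : ∀ t, ((∑ l, Real.exp (δ l * t) • S l) + (∑ l, Real.exp (δ l * t) • (!![w l 0, w l 1; w l 1, w l 2] : Matrix (Fin 2) (Fin 2) ℝ))).det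
        - (∑ l, Real.exp (δ l * t) • S l).det - (∑ l, Real.exp (δ l * t) • (!![w l 0, w l 1; w l 1, w l 2] : Matrix (Fin 2) (Fin 2) ℝ)).det
        = (∑ l, c l * Real.exp (δ l * t)) * ((P t + pstar).det - (P t).det - pstar.det) := by
      intro t; rw [hQ t, pol_smul_right_fin_two]
    -- admissibility at `t⋆`: `pol(p⋆, p⋆) = 2 det p⋆ = 0`
    have hpp : (pstar + pstar).det - pstar.det - pstar.det = 0 := by
      have : pstar + pstar = (2 : ℝ) • pstar := by rw [two_smul]
      rw [this, Matrix.det_smul, hdet0]; simp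
    have hadm : ∀ j, m j = 3 →
        ((∑ l, Real.exp (δ l * z j) • S l) + (∑ l, Real.exp (δ l * z j) • (!![w l 0, w l 1; w l 1, w l 2] : Matrix (Fin 2) (Fin 2) ℝ))).det
          - (∑ l, Real.exp (δ l * z j) • S l).det
          - (∑ l, Real.exp (δ l * z j) • (!![w l 0, w l 1; w l 1, w l 2] : Matrix (Fin 2) (Fin 2) ℝ)).det = 0 := by
      intro j hj
      rw [huniq j hj, hc1]
      show (∑ l, c l * Real.exp (δ l * tstar)) * ((pstar + pstar).det - pstar.det - pstar.det) = 0
      rw [hpp, mul_zero]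
    have hB := hbal w hadm
    -- evaluate the balance: the `t⋆` row vanishes, the touch rows are `φ(z_j)·pol(p_j, p⋆)`
    have hrow : ∀ j, lam j * (iteratedDeriv (m j) F (z j) *
        iteratedDeriv (m j - 2) (fun t => ((∑ l, Real.exp (δ l * t) • S l)
          + (∑ l, Real.exp (δ l * t) • (!![w l 0, w l 1; w l 1, w l 2] : Matrix (Fin 2) (Fin 2) ℝ))).det
          - (∑ l, Real.exp (δ l * t) • S l).det
          - (∑ l, Real.exp (δ l * t) • (!![w l 0, w l 1; w l 1, w l 2] : Matrix (Fin 2) (Fin 2) ℝ)).det) (z j))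
        = if j = j₀ then lam j₀ * (iteratedDeriv 2 F (z j₀) * ((P (z j₀) + pstar).det - (P (z j₀)).det - pstar.det)) else 0 := by
      intro j
      have hfun : (fun t => ((∑ l, Real.exp (δ l * t) • S l)
          + (∑ l, Real.exp (δ l * t) • (!![w l 0, w l 1; w l 1, w l 2] : Matrix (Fin 2) (Fin 2) ℝ))).det
          - (∑ l, Real.exp (δ l * t) • S l).det
          - (∑ l, Real.exp (δ l * t) • (!![w l 0, w l 1; w l 1, w l 2] : Matrix (Fin 2) (Fin 2) ℝ)).det)
          = fun t => (∑ l, c l * Real.exp (δ l * t)) * ((P t + pstar).det - (P t).det - pstar.det) := funext hc1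
      rw [hfun]
      rcases (by have := hm1 j; have := hm3 j; omega : m j = 1 ∨ m j = 2 ∨ m j = 3) with h | h | h
      · -- simple zero
        rw [hsimple j h, zero_mul]
        have : j ≠ j₀ := fun hj => by rw [hj, hj₀] at h; exact absurd h (by norm_num)
        rw [if_neg this]
      · -- touch: value row `φ(z_j)·pol(p_j,p⋆)` with `φ(z_j) = [j = j₀]`
        rw [h, show (2 : ℕ) - 2 = 0 from rfl, iteratedDeriv_zero]
        have hφ : (∑ l, c l * Real.exp (δ l * z j)) = if slot j = slot j₀ then 1 else 0 := by
          rw [← hslot j h]; exact hc (slot j)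
        by_cases hj : j = j₀
        · subst hj
          rw [if_pos rfl] at hφ
          rw [hφ, one_mul, if_pos rfl]
        · have hss : slot j ≠ slot j₀ := fun hs => hj (hslot_inj j j₀ h hj₀ hs)
          rw [if_neg hss] at hφ
          rw [hφ, zero_mul, mul_zero, mul_zero, if_neg hj]
      · -- the triple zero: slope row `φ′(t⋆)·pol(p⋆,p⋆) + φ(t⋆)·F′(t⋆) = 0`
        have hjj : j = jstar := huniq j h
        have hne : j ≠ j₀ := fun hj => by rw [hj] at h; rw [h] at hj₀; exact absurd hj₀ (by norm_num)
        rw [if_neg hne, h, show (3 : ℕ) - 2 = 1 from rfl, iteratedDeriv_one, hjj]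
        -- derivative of `φ · g` at `t⋆` with `g(t⋆) = 0` and `g′(t⋆) = F′(t⋆) = 0`
        have hφd : HasDerivAt (fun t => ∑ l, c l * Real.exp (δ l * t)) (∑ l, c l * (δ l * Real.exp (δ l * tstar))) tstar := by
          have hl : ∀ l, HasDerivAt (fun t => c l * Real.exp (δ l * t)) (c l * (δ l * Real.exp (δ l * tstar))) tstar := by
            intro l
            have h1 : HasDerivAt (fun t => Real.exp (δ l * t)) (Real.exp (δ l * tstar) * (δ l * 1)) tstar :=
              ((hasDerivAt_id tstar).const_mul (δ l)).exp
            exact (h1.const_mul (c l)).congr_deriv (by ring)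
          exact HasDerivAt.fun_sum (u := Finset.univ) (fun l _ => hl l)
        have hgd := hasDerivAt_pol_expPencil_const δ S pstar tstar
        -- `g′(t⋆) = F′(t⋆) = 0`
        have hg1 : (∑ l, δ l * Real.exp (δ l * tstar) * S l 0 0) * pstar 1 1 + (∑ l, δ l * Real.exp (δ l * tstar) * S l 1 1) * pstar 0 0
            - (∑ l, δ l * Real.exp (δ l * tstar) * S l 0 1) * pstar 1 0 - (∑ l, δ l * Real.exp (δ l * tstar) * S l 1 0) * pstar 0 1 = 0 := by
          have hd := deriv_det_expPencil_eq_pol δ S tstar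
          have h0 : deriv (fun t => (∑ l, Real.exp (δ l * t) • S l).det) tstar = 0 := hF1
          rw [h0] at hd
          show (∑ l, δ l * Real.exp (δ l * tstar) * S l 0 0) * (P tstar) 1 1 + (∑ l, δ l * Real.exp (δ l * tstar) * S l 1 1) * (P tstar) 0 0
            - (∑ l, δ l * Real.exp (δ l * tstar) * S l 0 1) * (P tstar) 1 0 - (∑ l, δ l * Real.exp (δ l * tstar) * S l 1 0) * (P tstar) 0 1 = 0
          simp only [hP] at hd ⊢
          linarith
        have hprod : HasDerivAt (fun t => (∑ l, c l * Real.exp (δ l * t)) * ((P t + pstar).det - (P t).det - pstar.det))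
            ((∑ l, c l * (δ l * Real.exp (δ l * tstar))) * ((P tstar + pstar).det - (P tstar).det - pstar.det)
              + (∑ l, c l * Real.exp (δ l * tstar)) *
                ((∑ l, δ l * Real.exp (δ l * tstar) * S l 0 0) * pstar 1 1 + (∑ l, δ l * Real.exp (δ l * tstar) * S l 1 1) * pstar 0 0
                  - (∑ l, δ l * Real.exp (δ l * tstar) * S l 0 1) * pstar 1 0 - (∑ l, δ l * Real.exp (δ l * tstar) * S l 1 0) * pstar 0 1)) tstar :=
          hφd.mul hgd
        rw [← htstar, hprod.deriv, hg1, mul_zero, add_zero]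
        have hg0 : (P tstar + pstar).det - (P tstar).det - pstar.det = 0 := hpp
        rw [hg0, mul_zero, mul_zero, mul_zero]
    rw [Finset.sum_congr rfl (fun j _ => hrow j), Finset.sum_ite_eq' Finset.univ j₀, if_pos (Finset.mem_univ _)] at hB
    -- conclude `lam j₀ = 0`
    have hA : iteratedDeriv 2 F (z j₀) ≠ 0 := by have := htop j₀; rwa [hj₀] at this
    rcases mul_eq_zero.1 hB with h | h
    · exact h
    · exact absurd h (mul_ne_zero hA hp)
  -- touches: parallel ones have `P(z_j) = c_j p⋆` with `c_j ≠ 0`-free consequences: `pol(P(z_j), Y) = c_j pol(p⋆, Y)`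
  have hpar_pol : ∀ j (cj : ℝ), P (z j) = cj • pstar → ∀ Y : Matrix (Fin 2) (Fin 2) ℝ,
      (P (z j) + Y).det - (P (z j)).det - Y.det = cj * ((pstar + Y).det - pstar.det - Y.det) := by
    intro j cj hcj Y
    rw [hcj]
    simp only [Matrix.det_fin_two, Matrix.add_apply, Matrix.smul_apply, smul_eq_mul]
    have : pstar 0 0 * pstar 1 1 - pstar 0 1 * pstar 1 0 = 0 := by rw [← Matrix.det_fin_two]; exact hdet0
    nlinarith [this]
  -- STEP 2: the triple-zero multiplier vanishes (ruling `Q = e^{δ₀ t}·β`)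
  have hstar : lam jstar = 0 := by
    let c : Fin 6 → ℝ := fun l => if l = 0 then 1 else 0
    have hφ : ∀ t, (∑ l, c l * Real.exp (δ l * t)) = Real.exp (δ 0 * t) := by
      intro t; simp [c]
    let w : Fin 6 → Fin 3 → ℝ := fun l => ![c l * β 0 0, c l * β 0 1, c l * β 1 1]
    have hQ : ∀ t, (∑ l, Real.exp (δ l * t) • (!![w l 0, w l 1; w l 1, w l 2] : Matrix (Fin 2) (Fin 2) ℝ))
        = (∑ l, c l * Real.exp (δ l * t)) • β := by
      intro t
      have := hshift c β hβs t
      simpa only [w, Matrix.cons_val_zero, Matrix.cons_val_one, Matrix.head_cons, Matrix.cons_val_two, Matrix.tail_cons] using this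
    have hc1 : ∀ t, ((∑ l, Real.exp (δ l * t) • S l) + (∑ l, Real.exp (δ l * t) • (!![w l 0, w l 1; w l 1, w l 2] : Matrix (Fin 2) (Fin 2) ℝ))).det
        - (∑ l, Real.exp (δ l * t) • S l).det - (∑ l, Real.exp (δ l * t) • (!![w l 0, w l 1; w l 1, w l 2] : Matrix (Fin 2) (Fin 2) ℝ)).det
        = (∑ l, c l * Real.exp (δ l * t)) * ((P t + β).det - (P t).det - β.det) := by
      intro t; rw [hQ t, pol_smul_right_fin_two]
    have hβ0' : (pstar + β).det - pstar.det - β.det = 0 := hβ0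
    have hadm : ∀ j, m j = 3 →
        ((∑ l, Real.exp (δ l * z j) • S l) + (∑ l, Real.exp (δ l * z j) • (!![w l 0, w l 1; w l 1, w l 2] : Matrix (Fin 2) (Fin 2) ℝ))).det
          - (∑ l, Real.exp (δ l * z j) • S l).det
          - (∑ l, Real.exp (δ l * z j) • (!![w l 0, w l 1; w l 1, w l 2] : Matrix (Fin 2) (Fin 2) ℝ)).det = 0 := by
      intro j hj
      rw [huniq j hj, hc1]
      show (∑ l, c l * Real.exp (δ l * tstar)) * ((pstar + β).det - pstar.det - β.det) = 0
      rw [hβ0', mul_zero]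
    have hB := hbal w hadm
    have hrow : ∀ j, lam j * (iteratedDeriv (m j) F (z j) *
        iteratedDeriv (m j - 2) (fun t => ((∑ l, Real.exp (δ l * t) • S l)
          + (∑ l, Real.exp (δ l * t) • (!![w l 0, w l 1; w l 1, w l 2] : Matrix (Fin 2) (Fin 2) ℝ))).det
          - (∑ l, Real.exp (δ l * t) • S l).det
          - (∑ l, Real.exp (δ l * t) • (!![w l 0, w l 1; w l 1, w l 2] : Matrix (Fin 2) (Fin 2) ℝ)).det) (z j))
        = if j = jstar then lam jstar * (iteratedDeriv 3 F tstar * (Real.exp (δ 0 * tstar) *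
            ((∑ l, δ l * Real.exp (δ l * tstar) * S l 0 0) * β 1 1 + (∑ l, δ l * Real.exp (δ l * tstar) * S l 1 1) * β 0 0
              - (∑ l, δ l * Real.exp (δ l * tstar) * S l 0 1) * β 1 0 - (∑ l, δ l * Real.exp (δ l * tstar) * S l 1 0) * β 0 1))) else 0 := by
      intro j
      have hfun : (fun t => ((∑ l, Real.exp (δ l * t) • S l)
          + (∑ l, Real.exp (δ l * t) • (!![w l 0, w l 1; w l 1, w l 2] : Matrix (Fin 2) (Fin 2) ℝ))).det
          - (∑ l, Real.exp (δ l * t) • S l).det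
          - (∑ l, Real.exp (δ l * t) • (!![w l 0, w l 1; w l 1, w l 2] : Matrix (Fin 2) (Fin 2) ℝ)).det)
          = fun t => (∑ l, c l * Real.exp (δ l * t)) * ((P t + β).det - (P t).det - β.det) := funext hc1
      rw [hfun]
      rcases (by have := hm1 j; have := hm3 j; omega : m j = 1 ∨ m j = 2 ∨ m j = 3) with h | h | h
      · rw [hsimple j h, zero_mul]
        have : j ≠ jstar := fun hj => by rw [hj, hjstar] at h; exact absurd h (by norm_num)
        rw [if_neg this]
      · have hne : j ≠ jstar := fun hj => by rw [hj, hjstar] at h; exact absurd h (by norm_num)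
        rw [if_neg hne]
        rcases hclass j h with hnp | ⟨cj, hcj⟩
        · rw [htouch j h hnp, zero_mul]
        · -- parallel touch: the value row is `φ(z_j)·c_j·pol(p⋆, β) = 0`
          rw [h, show (2 : ℕ) - 2 = 0 from rfl, iteratedDeriv_zero, hpar_pol j cj hcj β, hβ0']
          ring
      · have hjj : j = jstar := huniq j h
        rw [h, show (3 : ℕ) - 2 = 1 from rfl, iteratedDeriv_one, if_pos hjj, hjj]
        have hφd : HasDerivAt (fun t => ∑ l, c l * Real.exp (δ l * t)) (δ 0 * Real.exp (δ 0 * tstar)) tstar := by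
          have hfun : (fun t => ∑ l, c l * Real.exp (δ l * t)) = fun t => Real.exp (δ 0 * t) := funext hφ
          rw [hfun]
          exact (((hasDerivAt_id tstar).const_mul (δ 0)).exp).congr_deriv (by simp [mul_comm])
        have hgd := hasDerivAt_pol_expPencil_const δ S β tstar
        have hprod : HasDerivAt (fun t => (∑ l, c l * Real.exp (δ l * t)) * ((P t + β).det - (P t).det - β.det))
            (δ 0 * Real.exp (δ 0 * tstar) * ((P tstar + β).det - (P tstar).det - β.det)
              + (∑ l, c l * Real.exp (δ l * tstar)) *
                ((∑ l, δ l * Real.exp (δ l * tstar) * S l 0 0) * β 1 1 + (∑ l, δ l * Real.exp (δ l * tstar) * S l 1 1) * β 0 0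
                  - (∑ l, δ l * Real.exp (δ l * tstar) * S l 0 1) * β 1 0 - (∑ l, δ l * Real.exp (δ l * tstar) * S l 1 0) * β 0 1)) tstar :=
          hφd.mul hgd
        rw [← htstar, hprod.deriv, hφ tstar]
        have h0 : (P tstar + β).det - (P tstar).det - β.det = 0 := hβ0
        rw [h0, mul_zero, zero_add]
    rw [Finset.sum_congr rfl (fun j _ => hrow j), Finset.sum_ite_eq' Finset.univ jstar, if_pos (Finset.mem_univ _)] at hB
    have hA : iteratedDeriv 3 F tstar ≠ 0 := by have := htop jstar; rwa [hjstar] at this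
    have hE : Real.exp (δ 0 * tstar) ≠ 0 := (Real.exp_pos _).ne'
    rcases mul_eq_zero.1 hB with h | h
    · exact h
    · exact absurd h (mul_ne_zero hA (mul_ne_zero hE hβ1))
  -- STEP 3: every PARALLEL touch multiplier vanishes (scalar ruling `Q = φ·1`, `φ(t⋆) = 0`, `φ(z_j) = [j = j₀]` on the parallel touches)
  have hpar : ∀ j₀, m j₀ = 2 → lam j₀ = 0 := by
    intro j₀ hj₀
    rcases hclass j₀ hj₀ with hnp | ⟨cj₀, hcj₀⟩
    · exact htouch j₀ hj₀ hnp
    obtain ⟨c, hc⟩ := exists_expSum_interpolate δ hδ u' hu' (fun a => if a = slot' j₀ then 1 else 0)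
    let w : Fin 6 → Fin 3 → ℝ := fun l => ![c l * (1 : Matrix (Fin 2) (Fin 2) ℝ) 0 0, c l * (1 : Matrix (Fin 2) (Fin 2) ℝ) 0 1,
      c l * (1 : Matrix (Fin 2) (Fin 2) ℝ) 1 1]
    have hQ : ∀ t, (∑ l, Real.exp (δ l * t) • (!![w l 0, w l 1; w l 1, w l 2] : Matrix (Fin 2) (Fin 2) ℝ))
        = (∑ l, c l * Real.exp (δ l * t)) • (1 : Matrix (Fin 2) (Fin 2) ℝ) := by
      intro t
      have := hshift c 1 Matrix.isSymm_one t
      simpa only [w, Matrix.cons_val_zero, Matrix.cons_val_one, Matrix.head_cons, Matrix.cons_val_two, Matrix.tail_cons] using this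
    have hc1 : ∀ t, ((∑ l, Real.exp (δ l * t) • S l) + (∑ l, Real.exp (δ l * t) • (!![w l 0, w l 1; w l 1, w l 2] : Matrix (Fin 2) (Fin 2) ℝ))).det
        - (∑ l, Real.exp (δ l * t) • S l).det - (∑ l, Real.exp (δ l * t) • (!![w l 0, w l 1; w l 1, w l 2] : Matrix (Fin 2) (Fin 2) ℝ)).det
        = (∑ l, c l * Real.exp (δ l * t)) * (P t).trace := by
      intro t; rw [hQ t, pol_smul_one_fin_two]
    -- `φ(t⋆) = 0` (t⋆ occupies its own slot, distinct from the slot of `j₀`)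
    have hφstar : (∑ l, c l * Real.exp (δ l * tstar)) = 0 := by
      have hs : slot' jstar ≠ slot' j₀ := fun hs => by
        have := hslot'_inj jstar j₀ (Or.inr hjstar) (Or.inl hj₀) hs
        rw [this, hj₀] at hjstar; exact absurd hjstar (by norm_num)
      rw [htstar, ← hslot' jstar (Or.inr hjstar), hc (slot' jstar), if_neg hs]
    have hadm : ∀ j, m j = 3 →
        ((∑ l, Real.exp (δ l * z j) • S l) + (∑ l, Real.exp (δ l * z j) • (!![w l 0, w l 1; w l 1, w l 2] : Matrix (Fin 2) (Fin 2) ℝ))).det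
          - (∑ l, Real.exp (δ l * z j) • S l).det
          - (∑ l, Real.exp (δ l * z j) • (!![w l 0, w l 1; w l 1, w l 2] : Matrix (Fin 2) (Fin 2) ℝ)).det = 0 := by
      intro j hj
      rw [huniq j hj, hc1]
      show (∑ l, c l * Real.exp (δ l * tstar)) * (P tstar).trace = 0
      rw [hφstar, zero_mul]
    have hB := hbal w hadm
    have hrow : ∀ j, lam j * (iteratedDeriv (m j) F (z j) *
        iteratedDeriv (m j - 2) (fun t => ((∑ l, Real.exp (δ l * t) • S l)
          + (∑ l, Real.exp (δ l * t) • (!![w l 0, w l 1; w l 1, w l 2] : Matrix (Fin 2) (Fin 2) ℝ))).det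
          - (∑ l, Real.exp (δ l * t) • S l).det
          - (∑ l, Real.exp (δ l * t) • (!![w l 0, w l 1; w l 1, w l 2] : Matrix (Fin 2) (Fin 2) ℝ)).det) (z j))
        = if j = j₀ then lam j₀ * (iteratedDeriv 2 F (z j₀) * (P (z j₀)).trace) else 0 := by
      intro j
      have hfun : (fun t => ((∑ l, Real.exp (δ l * t) • S l)
          + (∑ l, Real.exp (δ l * t) • (!![w l 0, w l 1; w l 1, w l 2] : Matrix (Fin 2) (Fin 2) ℝ))).det
          - (∑ l, Real.exp (δ l * t) • S l).det
          - (∑ l, Real.exp (δ l * t) • (!![w l 0, w l 1; w l 1, w l 2] : Matrix (Fin 2) (Fin 2) ℝ)).det)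
          = fun t => (∑ l, c l * Real.exp (δ l * t)) * (P t).trace := funext hc1
      rw [hfun]
      rcases (by have := hm1 j; have := hm3 j; omega : m j = 1 ∨ m j = 2 ∨ m j = 3) with h | h | h
      · rw [hsimple j h, zero_mul]
        have : j ≠ j₀ := fun hj => by rw [hj, hj₀] at h; exact absurd h (by norm_num)
        rw [if_neg this]
      · rw [h, show (2 : ℕ) - 2 = 0 from rfl, iteratedDeriv_zero]
        have hφ : (∑ l, c l * Real.exp (δ l * z j)) = if slot' j = slot' j₀ then 1 else 0 := by
          rw [← hslot' j (Or.inl h)]; exact hc (slot' j)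
        by_cases hj : j = j₀
        · subst hj
          rw [if_pos rfl] at hφ
          rw [hφ, one_mul, if_pos rfl]
        · have hss : slot' j ≠ slot' j₀ := fun hs => hj (hslot'_inj j j₀ (Or.inl h) (Or.inl hj₀) hs)
          rw [if_neg hss] at hφ
          rw [hφ, zero_mul, mul_zero, mul_zero, if_neg hj]
      · have hjj : j = jstar := huniq j h
        have hne : j ≠ j₀ := fun hj => by rw [hj] at h; rw [h] at hj₀; exact absurd hj₀ (by norm_num)
        rw [if_neg hne, hjj, hstar, zero_mul]
    rw [Finset.sum_congr rfl (fun j _ => hrow j), Finset.sum_ite_eq' Finset.univ j₀, if_pos (Finset.mem_univ _)] at hB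
    have hA : iteratedDeriv 2 F (z j₀) ≠ 0 := by have := htop j₀; rwa [hj₀] at this
    rcases mul_eq_zero.1 hB with h | h
    · exact h
    · exact absurd h (mul_ne_zero hA (htrj j₀ hj₀))
  -- all multipliers vanish
  apply hlne
  funext j
  rcases (by have := hm1 j; have := hm3 j; omega : m j = 1 ∨ m j = 2 ∨ m j = 3) with h | h | h
  · exact hsimple j h
  · exact hpar j h
  · rw [huniq j h]; exact hstar

end Summit.ValiantsHypothesis.ValiantsHypothesis.Theorems.LacunarySymmetroidMatrixDescartes.WallBubbling
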